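import Mathlib.Analysis.Calculus.ParametricIntervalIntegral
import Mathlib.Analysis.Calculus.ContDiff.FiniteDimension
import Mathlib.MeasureTheory.Integral.DominatedConvergence
import Mathlib.MeasureTheory.Integral.IntervalIntegral.Basic
import HarnessLib

/-!
# Smooth dependence on parameters of integrals over a compact interval

Analysis/FunctionSpaces support file. The elementary calculus fact used whenever a smooth test
function is *manufactured by integrating a smooth function along a parameter* — Duhamel
formulas, solutions of transport equations along characteristics, averages of translates
(Evans, *PDE*, App. C, and §3.2 "characteristics"; Hörmander, *The Analysis of Linear Partial
Differential Operators I*, Thm. 1.1.7 ff.: differentiation under the integral sign):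

* `Literature.Analysis.FunctionSpaces.hasFDerivAt_parametric_intervalIntegral` — if `H : ℝ × P → F` is `C¹` (`P` a
  finite-dimensional real normed space), then `p ↦ ∫ σ in a..b, H (σ, p)` is differentiable with
  derivative `∫ σ in a..b, D_p H (σ, p)` (Mathlib's
  `intervalIntegral.hasFDerivAt_integral_of_dominated_of_fderiv_le`, the dominating constant
  coming from continuity of `DH` on the compact `[a, b] × closedBall p 1`);
* `Literature.Analysis.FunctionSpaces.contDiff_parametric_intervalIntegral` — if `H` is `C^∞` then so is
  `p ↦ ∫ σ in a..b, H (σ, p)` (induction on the order through Mathlib's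
  `contDiff_succ_iff_fderiv_apply`: each directional derivative is again such an integral, of
  the smooth function `(σ, p) ↦ D H (σ, p) (0, v)`).

## Mathlib search

Mathlib (this pin) has one derivative under the integral sign
(`hasFDerivAt_integral_of_dominated_of_fderiv_le`, interval version in
`Mathlib.Analysis.Calculus.ParametricIntervalIntegral`) and continuity of parametric interval
integrals (`intervalIntegral.continuous_parametric_intervalIntegral_of_continuous'`), but no
`ContDiff` statement for parametric integrals (searched `contDiff` + `integral` in
`Analysis/Calculus`, `MeasureTheory/Integral`: none).

## References

* L. C. Evans, *Partial Differential Equations*, 2nd ed. (2010), App. C.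
* L. Hörmander, *The Analysis of Linear Partial Differential Operators I*, 2nd ed. (1990),
  Thm. 1.1.7–1.1.9.
-/

noncomputable section

open MeasureTheory Set Filter Topology Metric intervalIntegral
open scoped ContDiff

namespace Literature.Analysis.FunctionSpaces

variable {P : Type*} [NormedAddCommGroup P] [NormedSpace ℝ P] [FiniteDimensional ℝ P]
variable {F : Type*} [NormedAddCommGroup F] [NormedSpace ℝ F]

omit [FiniteDimensional ℝ P] in
/-- The partial derivative in the parameter of `H : ℝ × P → F` at `(σ, p)`, as a continuous
linear map `P →L F`: `D H (σ, p) ∘ (0, ·)`. [folklore] -/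
theorem hasFDerivAt_comp_prodMk {H : ℝ × P → F} {n : WithTop ℕ∞} (hH : ContDiff ℝ n H)
    (hn : n ≠ 0) (σ : ℝ) (p : P) :
    HasFDerivAt (fun q : P => H (σ, q))
      ((fderiv ℝ H (σ, p)).comp (ContinuousLinearMap.inr ℝ ℝ P)) p := by
  have h1 : HasFDerivAt H (fderiv ℝ H (σ, p)) (σ, p) :=
    ((hH.differentiable hn) (σ, p)).hasFDerivAt
  have h2 : HasFDerivAt (fun q : P => ((σ, q) : ℝ × P)) (ContinuousLinearMap.inr ℝ ℝ P) p :=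
    (hasFDerivAt_const σ p).prodMk (hasFDerivAt_id p)
  exact h1.comp p h2

/-- **One derivative under the integral sign, smooth integrand on a compact interval.** If
`H : ℝ × P → F` is `C¹` then `p ↦ ∫ σ in a..b, H (σ, p)` has derivative
`∫ σ in a..b, D H (σ, p) ∘ (0, ·)` at every `p` (Evans, App. C; Mathlib's
`intervalIntegral.hasFDerivAt_integral_of_dominated_of_fderiv_le` with the constant bound given
by continuity of `DH` on the compact `[a, b] × closedBall p 1`). [folklore] -/
theorem hasFDerivAt_parametric_intervalIntegral {H : ℝ × P → F} {n : WithTop ℕ∞}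
    (hH : ContDiff ℝ n H) (hn : n ≠ 0) (a b : ℝ) (p₀ : P) :
    HasFDerivAt (fun p : P => ∫ σ in a..b, H (σ, p))
      (∫ σ in a..b, (fderiv ℝ H (σ, p₀)).comp (ContinuousLinearMap.inr ℝ ℝ P)) p₀ := by
  have hHc : Continuous H := hH.continuous
  have hDc : Continuous (fderiv ℝ H) := hH.continuous_fderiv hn
  -- the derivative family and a uniform bound on `[a, b] × closedBall p₀ 1`
  set F' : P → ℝ → P →L[ℝ] F :=
    fun p σ => (fderiv ℝ H (σ, p)).comp (ContinuousLinearMap.inr ℝ ℝ P) with hF'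
  have hF'c : Continuous (fun q : ℝ × P => F' q.2 q.1) := by
    simp only [hF']
    exact ((ContinuousLinearMap.compL ℝ P (ℝ × P) F).flip
      (ContinuousLinearMap.inr ℝ ℝ P)).continuous.comp hDc
  obtain ⟨C, hC⟩ : ∃ C, ∀ q ∈ (uIcc a b) ×ˢ closedBall p₀ 1, ‖F' q.2 q.1‖ ≤ C := by
    have hK : IsCompact ((uIcc a b) ×ˢ closedBall p₀ (1 : ℝ)) :=
      isCompact_uIcc.prod (isCompact_closedBall p₀ 1)
    obtain ⟨C, hC⟩ := hK.exists_bound_of_continuousOn hF'c.continuousOn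
    exact ⟨C, hC⟩
  refine intervalIntegral.hasFDerivAt_integral_of_dominated_of_fderiv_le
    (F := fun p σ => H (σ, p)) (F' := F') (bound := fun _ => C) (μ := volume)
    (ball_mem_nhds p₀ one_pos) ?_ ?_ ?_ ?_ ?_ ?_
  · exact Eventually.of_forall fun p =>
      (hHc.comp (continuous_id.prodMk continuous_const)).aestronglyMeasurable
  · exact (hHc.comp (continuous_id.prodMk continuous_const)).intervalIntegrable _ _
  · exact (hF'c.comp (continuous_id.prodMk continuous_const)).aestronglyMeasurable
  · refine Eventually.of_forall fun σ hσ p hp => hC (σ, p) ⟨?_, ?_⟩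
    · exact uIoc_subset_uIcc hσ
    · exact mem_closedBall.2 (le_of_lt (mem_ball.1 hp))
  · exact intervalIntegrable_const
  · exact Eventually.of_forall fun σ _ p _ => hasFDerivAt_comp_prodMk hH hn σ p

/-- The derivative of `p ↦ ∫ σ in a..b, H (σ, p)` in the direction `v` is the parametric
integral of the smooth function `(σ, p) ↦ D H (σ, p) (0, v)`. [folklore] -/
theorem fderiv_parametric_intervalIntegral_apply {H : ℝ × P → F} {n : WithTop ℕ∞}
    (hH : ContDiff ℝ n H) (hn : n ≠ 0) (a b : ℝ) (p : P) (v : P) :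
    fderiv ℝ (fun p : P => ∫ σ in a..b, H (σ, p)) p v =
      ∫ σ in a..b, fderiv ℝ H (σ, p) ((0 : ℝ), v) := by
  rw [(hasFDerivAt_parametric_intervalIntegral hH hn a b p).fderiv]
  have hDc : Continuous (fderiv ℝ H) := hH.continuous_fderiv hn
  have hc : Continuous fun σ : ℝ => (fderiv ℝ H (σ, p)).comp (ContinuousLinearMap.inr ℝ ℝ P) :=
    ((ContinuousLinearMap.compL ℝ P (ℝ × P) F).flip
      (ContinuousLinearMap.inr ℝ ℝ P)).continuous.comp
      (hDc.comp (continuous_id.prodMk continuous_const))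
  rw [ContinuousLinearMap.intervalIntegral_apply (hc.intervalIntegrable _ _)]
  rfl

/-- `p ↦ ∫ σ in a..b, H (σ, p)` is differentiable for `C¹` integrands. [folklore] -/
theorem differentiable_parametric_intervalIntegral {H : ℝ × P → F} {n : WithTop ℕ∞}
    (hH : ContDiff ℝ n H) (hn : n ≠ 0) (a b : ℝ) :
    Differentiable ℝ fun p : P => ∫ σ in a..b, H (σ, p) :=
  fun p => (hasFDerivAt_parametric_intervalIntegral hH hn a b p).differentiableAt

/-- `C^n` regularity of parametric integrals of smooth integrands, every `n : ℕ` (induction on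
`n`; the induction runs over all smooth `H` at once since the directional derivatives are
parametric integrals of the smooth functions `(σ, p) ↦ D H (σ, p) (0, v)`). [folklore] -/
theorem contDiff_nat_parametric_intervalIntegral (a b : ℝ) :
    ∀ (n : ℕ) {H : ℝ × P → F}, ContDiff ℝ ∞ H → ContDiff ℝ n fun p : P => ∫ σ in a..b, H (σ, p)
  | 0, H, hH => by
    rw [Nat.cast_zero, contDiff_zero]
    exact intervalIntegral.continuous_parametric_intervalIntegral_of_continuous'
      (f := fun p σ => H (σ, p)) (hH.continuous.comp (continuous_snd.prodMk continuous_fst)) a b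
  | n + 1, H, hH => by
    have h1 : (∞ : WithTop ℕ∞) ≠ 0 := by exact_mod_cast WithTop.coe_ne_zero.2 (by decide)
    rw [Nat.cast_succ, contDiff_succ_iff_fderiv_apply]
    refine ⟨differentiable_parametric_intervalIntegral hH h1 a b, fun h => ?_, fun v => ?_⟩
    · exact absurd h (by exact_mod_cast WithTop.coe_ne_top)
    · have hv : (fun p : P => fderiv ℝ (fun p : P => ∫ σ in a..b, H (σ, p)) p v) =
          fun p : P => ∫ σ in a..b, fderiv ℝ H (σ, p) ((0 : ℝ), v) :=
        funext fun p => fderiv_parametric_intervalIntegral_apply hH h1 a b p v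
      rw [hv]
      refine contDiff_nat_parametric_intervalIntegral a b n (H := fun q => fderiv ℝ H q ((0 : ℝ), v)) ?_
      exact (hH.fderiv_right (m := ∞) le_rfl).clm_apply contDiff_const

/-- **Smooth dependence on parameters.** If `H : ℝ × P → F` is `C^∞` (`P` finite dimensional,
`F` complete), then `p ↦ ∫ σ in a..b, H (σ, p)` is `C^∞` (Evans, App. C; Hörmander, Thm. 1.1.9,
iterated differentiation under the integral sign). [folklore] -/
theorem contDiff_parametric_intervalIntegral {H : ℝ × P → F} (hH : ContDiff ℝ ∞ H) (a b : ℝ) :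
    ContDiff ℝ ∞ fun p : P => ∫ σ in a..b, H (σ, p) :=
  contDiff_infty.2 fun n => contDiff_nat_parametric_intervalIntegral a b n hH

/-- The frequently used composite form: `p ↦ ∫ σ in a..b, G (A (σ, p))` is `C^∞` for a smooth
`G : Q → F` and a smooth reparametrisation `A : ℝ × P → Q` (compose first, then apply
`contDiff_parametric_intervalIntegral`). [folklore] -/
theorem contDiff_parametric_intervalIntegral_comp {Q : Type*} [NormedAddCommGroup Q]
    [NormedSpace ℝ Q] {G : Q → F} (hG : ContDiff ℝ ∞ G) {A : ℝ × P → Q} (hA : ContDiff ℝ ∞ A)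
    (a b : ℝ) : ContDiff ℝ ∞ fun p : P => ∫ σ in a..b, G (A (σ, p)) :=
  contDiff_parametric_intervalIntegral (hG.comp hA) a b

end Literature.Analysis.FunctionSpaces

end
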